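import Summits.QuantumFields.YangMills.Theorems.SlowBitWindowInsertionTracePeeling
import Summits.QuantumFields.YangMills.Theorems.LuscherReductionRunningReductionTraceFormula
import Summits.QuantumFields.YangMills.Theorems.FemtoTransferGapAxisPermutation
import Literature.Analysis.OperatorTheory.PositiveKernelSpectralTrace
import HarnessLib

/-!
# Two-insertion zero-flux thermal traces: the spectral representation `Tr_phys(M_O T^m M_O T^{2L-m}) = Σ λ_k^{2L-m} λ_l^m ⟨e_l, O e_k⟩²`

Support module for the doors `SlowBitWindow.TraceDoor` (stmt-QuantumFields-23273) and `SlowBitWindow.JensenDoor`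
(stmt-QuantumFields-23274) of route `SlowBitWindow` (D-0145 LINE g10-A of seat ym-idea-4).  Main theorem
**`insTrace_spectral`**: for `β > 0` and a physical observable `O` with `|O| ≤ C_O` there is ONE sequence `e : ℕ → (GaugeConfig → ℝ)` of
physical zero-flux test functions — seat ym-infvol-p2's complete physical eigenbasis `exists_isPhys_eigenseq`
(`K_β e_k = λ_k e_k`, `λ_k = levelValue su2Rep L β k`, `l2`-orthonormal, complete modulo the kernel), whose `e_0` is a raw vacuum and hence
invariant under axis permutations (`rawVacuum_comp_configPerm`) — such that for every `1 ≤ m ≤ 2L - 2`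

  `insTrace L β O m = Σ_{(k,l) ∈ ℕ × ℕ} λ_k^{2L-m} λ_l^m c_{kl}`,  `c_{kl} = (∫ O e_k e_l dμ)²`  (a `HasSum` over `ℕ × ℕ`),

with the Bessel bound `Σ_l c_{kl} ≤ C_O²` for every `k`.  Proof: the one-bond-insertion form of the companion module
(`insTrace_eq_insertOne`: composite bond `X_m(x,y) = O(x) K_β^{P,(m)}(x,y) O(y)` followed by `2L - m` bonds `K_β^P`) is fed to Literature
`hasSum_integral_iterate_insert_one` along the Hilbert basis of `L²(configMeasure)` «`e_k` ⊕ a Hilbert basis of the orthogonal complement of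
their closed span» (an eigenbasis of the `L²` operator `A_P` of `K_β^P`, eigenvalues `λ_k` resp. `0`, exactly as in `TT.traceFormula`); the
diagonal matrix element `⟨e_k, 𝕏_m e_k⟩ = ⟨O e_k, A_P^m (O e_k)⟩` (composed kernel = kernel of the power, `integral_iterKernelP_mul`,
`pow_kernelOp_toLp_ae_eq_iterate`) is opened by Parseval into `Σ_l λ_l^m ⟨e_l, O e_k⟩²`; non-negativity of all terms turns the iterated sum
into a double sum.

HONEST FRAMING: fixed-lattice spectral bookkeeping (Reed–Simon I Thm. VI.22–23) for M-sized support items of a DRAFT line onto a RECORD rung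
(K2a); no renormalisation-group content; nothing here bears on infinite volume, the continuum limit, a mass gap or Clay.
References: [cite: ReedSimonI1980, Thm. VI.22–VI.23]; [cite: ReedSimonIV1978, Thm. XIII.1]; [cite: MontvayMunster1994, (3.145)].
-/

set_option autoImplicit false

noncomputable section

open MeasureTheory Filter Topology Function
open Literature.MathematicalPhysics.QuantumFieldTheory
open Literature.MathematicalPhysics.QuantumLattice
open Literature.Analysis.OperatorTheory.YMMatrixModel
open Literature.Analysis.OperatorTheory
open scoped InnerProductSpace BigOperators

namespace Summit.QuantumFields.YangMills.Theorems.FemtoTransferGap.TT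

open Summit.QuantumFields.YangMills.Theorems.FemtoTransferGap
open Summit.QuantumFields.YangMills.Theorems.FemtoTransferGap.PhysL2

variable {L : ℕ} [NeZero L]

/-! ## §1 Two abstract Hilbert-space identities -/

/-- `⟪v, A^m v⟫ = Σᵢ λᵢ^m ⟪bᵢ, v⟫²` along an orthonormal eigenbasis of a self-adjoint `A`. [folklore] -/
theorem hasSum_inner_pow_apply_self {E : Type*} [NormedAddCommGroup E] [InnerProductSpace ℝ E] [CompleteSpace E] {ι : Type*}
    (b : HilbertBasis ι ℝ E) {A : E →L[ℝ] E} (hsa : IsSelfAdjoint A) {lam : ι → ℝ} (hb : ∀ i, A (b i) = lam i • b i)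
    (m : ℕ) (v : E) :
    HasSum (fun i => lam i ^ m * ⟪b i, v⟫_ℝ ^ 2) ⟪v, (A ^ m) v⟫_ℝ := by
  have hpow : ∀ i, (A ^ m) (b i) = lam i ^ m • b i := by
    intro i
    induction m with
    | zero => simp
    | succ m ih => rw [pow_succ', mul_apply_eq_comp, ih, map_smul, hb, smul_smul, pow_succ, mul_comm]
  have h := b.hasSum_inner_mul_inner v ((A ^ m) v)
  refine h.congr_fun fun i => ?_
  rw [← (hsa.pow m).adjoint_eq, ContinuousLinearMap.adjoint_inner_right, hpow i, real_inner_smul_left, real_inner_comm (b i) v]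
  ring

/-- `Σᵢ ⟪bᵢ, v⟫² = ‖v‖²` (Parseval). [folklore] -/
theorem hasSum_inner_sq_norm_sq {E : Type*} [NormedAddCommGroup E] [InnerProductSpace ℝ E] [CompleteSpace E] {ι : Type*}
    (b : HilbertBasis ι ℝ E) (v : E) : HasSum (fun i => ⟪b i, v⟫_ℝ ^ 2) (‖v‖ ^ 2) := by
  have h := b.hasSum_inner_mul_inner v v
  rw [real_inner_self_eq_norm_sq] at h
  refine h.congr_fun fun i => ?_
  rw [real_inner_comm (b i) v, sq]

/-! ## §2 The spectral representation of the two-insertion trace -/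

set_option maxHeartbeats 1600000 in
/-- **Spectral representation of the two-insertion zero-flux thermal trace.**  For `β > 0` and a physical `O` with `|O| ≤ C_O` there is a
sequence `e_k` of physical zero-flux test functions — `l2`-orthonormal exact eigenfunctions `K_β e_k = λ_k e_k`, `λ_k = levelValue su2Rep L β k`,
with `e_0` invariant under axis permutations — such that for `1 ≤ m`, `m + 2 ≤ 2L`:
`insTrace L β O m = Σ_{(k,l)} λ_k^{2L-m} λ_l^m (∫ O e_k e_l)²` (`Tr_phys(M_O T^m M_O T^{2L-m})` in the eigenbasis of `T = P K_β P`), and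
`Σ_l (∫ O e_k e_l)² ≤ C_O²` for every `k`. [cite: ReedSimonI1980, Thm. VI.22–VI.23] [cite: MontvayMunster1994, (3.145)] -/
theorem insTrace_spectral {β : ℝ} (hβ : 0 < β) {O : GaugeConfig 3 L SU2 → ℝ} (hO : IsPhys O) {CO : ℝ} (hOb : ∀ U, |O U| ≤ CO) :
    ∃ e : ℕ → (GaugeConfig 3 L SU2 → ℝ),
      (∀ k, IsPhys (e k)) ∧
      (∀ k l, l2 (e k) (e l) = if k = l then 1 else 0) ∧
      (∀ k, transferApply β (e k) = levelValue su2Rep L β k • e k) ∧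
      (∀ (σ : Equiv.Perm (Fin 3)) (U : GaugeConfig 3 L SU2), e 0 (configPerm σ U) = e 0 U) ∧
      (∀ k, Summable (fun l : ℕ => (∫ U, O U * e k U * e l U ∂configMeasure SU2 L) ^ 2) ∧
        ∑' l : ℕ, (∫ U, O U * e k U * e l U ∂configMeasure SU2 L) ^ 2 ≤ CO ^ 2) ∧
      ∀ m : ℕ, 1 ≤ m → m + 2 ≤ 2 * L →
        HasSum (fun p : ℕ × ℕ => levelValue su2Rep L β p.1 ^ (2 * L - m) * levelValue su2Rep L β p.2 ^ m *
          (∫ U, O U * e p.1 U * e p.2 U ∂configMeasure SU2 L) ^ 2) (insTrace L β O m) := by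
  classical
  haveI : SecondCountableTopology SU2 := secondCountableTopology_su2
  haveI : Fact ((2 : ENNReal) ≠ ⊤) := ⟨ENNReal.ofNat_ne_top⟩
  haveI : CompleteSpace (physL2 L) := isClosed_physL2.completeSpace_coe
  have hCO : 0 ≤ CO := (abs_nonneg _).trans (hOb (fun _ => 1))
  obtain ⟨M0, -, hM0⟩ := exists_abs_transferKernel_le (L := L) β
  -- the two `L²` operators
  obtain ⟨A, hA, hsa, -⟩ := exists_transferOpL2 (L := L) β
  have hKP := stronglyMeasurable_physKernel (L := L) β
  have hCP : ∀ U V : GaugeConfig 3 L SU2, ‖physKernel β U V‖ ≤ M0 := fun U V => by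
    rw [Real.norm_eq_abs]; exact abs_physKernel_le hM0 U V
  obtain ⟨AP, hAP⟩ := exists_kernelOp (μ := configMeasure SU2 L) hKP hCP
  have hsaP : IsSelfAdjoint AP := isSelfAdjoint_kernelOp hKP hCP (physKernel_symm β) hAP
  -- the honest physical eigen-sequence
  obtain ⟨e, hon, heig, -, hker⟩ := exists_isPhys_eigenseq (L := L) hβ
  set u : ℕ → Lp ℝ 2 (configMeasure SU2 L) := fun n => toL2 (e n) with hu
  have hu_on : Orthonormal ℝ u := by
    rw [orthonormal_iff_ite]
    intro i l
    rw [hu, inner_toL2]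
    exact hon i l
  have hAe : ∀ k, A (u k) = levelValue su2Rep L β k • u k := fun k => by
    have h1 : transferOp β (e k) = levelValue su2Rep L β k • e k := Subtype.ext (by rw [coe_transferOp, heig k]; rfl)
    simp only [hu]
    rw [apply_toL2 hA, h1, map_smul]
  have hkerA : ∀ x : Lp ℝ 2 (configMeasure SU2 L), x ∈ physL2 L → (∀ i, ⟪u i, x⟫_ℝ = 0) → A x = 0 := by
    intro x hx hx'
    have h0 := hker x hx hx'
    apply Lp.ext
    filter_upwards [hA x, Lp.coeFn_zero ℝ 2 (configMeasure SU2 L)] with U h1 h2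
    rw [h1, h2, Pi.zero_apply, h0 U]
  -- the Hilbert basis «`u` ⊕ a Hilbert basis of the orthogonal complement of its closed span»
  set E : Submodule ℝ (Lp ℝ 2 (configMeasure SU2 L)) := (Submodule.span ℝ (Set.range u)).topologicalClosure with hE
  have hu_mem : ∀ n, u n ∈ E := fun n => Submodule.le_topologicalClosure _ (Submodule.subset_span (Set.mem_range_self n))
  have hu_phys : ∀ n, u n ∈ physL2 L := fun n => toL2_mem_physL2 (e n)
  obtain ⟨w, c, hwc⟩ := exists_hilbertBasis ℝ (↥Eᗮ)
  have hc_on' : Orthonormal ℝ ((↑) : w → ↥Eᗮ) := hwc ▸ c.orthonormal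
  haveI : Countable w := (hc_on'.countable_of_separableSpace (𝕜 := ℝ)).to_subtype
  have hc_on : Orthonormal ℝ (fun j : w => (((j : ↥Eᗮ)) : Lp ℝ 2 (configMeasure SU2 L))) :=
    Eᗮ.subtypeₗᵢ.orthonormal_comp_iff.mpr hc_on'
  set v : ℕ ⊕ w → Lp ℝ 2 (configMeasure SU2 L) := Sum.elim u (fun j : w => ((j : ↥Eᗮ) : Lp ℝ 2 (configMeasure SU2 L))) with hvdef
  have hv : Orthonormal ℝ v := by
    rw [orthonormal_iff_ite]
    rintro (n | j) (n' | j')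
    · simp only [hvdef, Sum.elim_inl, Sum.inl.injEq]
      exact (orthonormal_iff_ite.mp hu_on) n n'
    · simp only [hvdef, Sum.elim_inl, Sum.elim_inr, reduceCtorEq, if_false]
      exact Submodule.inner_right_of_mem_orthogonal (hu_mem n) (j' : ↥Eᗮ).2
    · simp only [hvdef, Sum.elim_inl, Sum.elim_inr, reduceCtorEq, if_false]
      exact Submodule.inner_left_of_mem_orthogonal (hu_mem n') (j : ↥Eᗮ).2
    · simp only [hvdef, Sum.elim_inr, Sum.inr.injEq]
      exact (orthonormal_iff_ite.mp hc_on) j j'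
  have hrange : Set.range u ⊆ Set.range v := by
    rintro _ ⟨n, rfl⟩; exact ⟨Sum.inl n, rfl⟩
  have hspan : (Submodule.span ℝ (Set.range v))ᗮ = ⊥ := by
    rw [Submodule.eq_bot_iff]
    intro y hy
    have hyv : ∀ i, ⟪v i, y⟫_ℝ = 0 := fun i =>
      Submodule.inner_right_of_mem_orthogonal (Submodule.subset_span (Set.mem_range_self i)) hy
    have hyE : y ∈ Eᗮ := by
      rw [Submodule.mem_orthogonal]
      intro z hz
      have hS : IsClosed {z : Lp ℝ 2 (configMeasure SU2 L) | ⟪z, y⟫_ℝ = 0} :=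
        isClosed_eq (continuous_id.inner continuous_const) continuous_const
      have hsub : ((Submodule.span ℝ (Set.range u) : Submodule ℝ (Lp ℝ 2 (configMeasure SU2 L))) :
          Set (Lp ℝ 2 (configMeasure SU2 L))) ⊆ {z | ⟪z, y⟫_ℝ = 0} := fun z hz =>
        Submodule.inner_right_of_mem_orthogonal (Submodule.span_mono hrange hz) hy
      have hz' : z ∈ closure ((Submodule.span ℝ (Set.range u) : Submodule ℝ (Lp ℝ 2 (configMeasure SU2 L))) :
          Set (Lp ℝ 2 (configMeasure SU2 L))) := by
        rw [← Submodule.topologicalClosure_coe]; exact hz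
      exact closure_minimal hsub hS hz'
    set y' : ↥Eᗮ := ⟨y, hyE⟩ with hy'
    have hc0 : ∀ j : w, ⟪c j, y'⟫_ℝ = 0 := fun j => by
      rw [show c j = (j : ↥Eᗮ) from congrFun hwc j, Submodule.coe_inner]
      exact hyv (Sum.inr j)
    have hrepr : c.repr y' = 0 := by
      ext j
      rw [c.repr_apply_apply, hc0 j]
      rfl
    have hy'0 : y' = 0 := by simpa using congrArg c.repr.symm hrepr
    exact congrArg Subtype.val hy'0
  set b : HilbertBasis (ℕ ⊕ w) ℝ (Lp ℝ 2 (configMeasure SU2 L)) := HilbertBasis.mkOfOrthogonalEqBot hv hspan with hbdef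
  have hb : ∀ i, b i = v i := fun i => by rw [hbdef, HilbertBasis.coe_mkOfOrthogonalEqBot]
  -- eigen-relations of the operator of `K_β^P` along `b`
  set lam : ℕ ⊕ w → ℝ := Sum.elim (fun k => levelValue su2Rep L β k) (fun _ => 0) with hlamdef
  have hbAP : ∀ i, AP (b i) = lam i • b i := by
    intro i
    rw [hb]
    rcases i with n | j
    · simp only [hvdef, hlamdef, Sum.elim_inl]
      rw [kernelOpP_apply_of_mem_physL2 hM0 hA hAP (hu_phys n), hAe]
    · simp only [hvdef, hlamdef, Sum.elim_inr, zero_smul]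
      set y : Lp ℝ 2 (configMeasure SU2 L) := ((j : ↥Eᗮ) : Lp ℝ 2 (configMeasure SU2 L)) with hydef
      have hyE : y ∈ Eᗮ := (j : ↥Eᗮ).2
      set y₁ : Lp ℝ 2 (configMeasure SU2 L) := (physL2 L).starProjection y with hy₁def
      have hy₁ : y₁ ∈ physL2 L := Submodule.starProjection_apply_mem _ y
      have hy₂ : y - y₁ ∈ (physL2 L)ᗮ := Submodule.sub_starProjection_mem_orthogonal y
      have h1 : AP (y - y₁) = 0 := kernelOpP_apply_of_mem_orthogonal hM0 hAP hy₂
      have h2 : AP y₁ = A y₁ := kernelOpP_apply_of_mem_physL2 hM0 hA hAP hy₁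
      have h3 : A y₁ = 0 := by
        refine hkerA y₁ hy₁ fun i => ?_
        have ha : ⟪u i, y⟫_ℝ = 0 := Submodule.inner_right_of_mem_orthogonal (hu_mem i) hyE
        have hb' : ⟪u i, y - y₁⟫_ℝ = 0 := Submodule.inner_right_of_mem_orthogonal (hu_phys i) hy₂
        have hsplit : ⟪u i, y₁⟫_ℝ = ⟪u i, y⟫_ℝ - ⟪u i, y - y₁⟫_ℝ := by
          rw [← inner_sub_right, sub_sub_cancel]
        rw [hsplit, ha, hb', sub_zero]
      calc AP y = AP (y₁ + (y - y₁)) := by rw [add_sub_cancel]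
        _ = AP y₁ + AP (y - y₁) := map_add _ _ _
        _ = 0 := by rw [h1, h2, h3, add_zero]
  -- the data of the conclusion
  set ef : ℕ → GaugeConfig 3 L SU2 → ℝ := fun k => ((e k : physSubmodule L) : GaugeConfig 3 L SU2 → ℝ) with hef
  have hef_phys : ∀ k, IsPhys (ef k) := fun k => isPhys_coe (e k)
  -- the honest bounded observable `g_k = O · e_k`, its class, and its coefficients
  have hgm : ∀ k, Measurable fun U => O U * ef k U := fun k => hO.measurable.mul (hef_phys k).measurable
  have hgb : ∀ k, ∃ B, ∀ U, ‖O U * ef k U‖ ≤ B := fun k => by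
    obtain ⟨D, hD⟩ := (hef_phys k).bounded
    exact ⟨CO * D, fun U => by rw [norm_mul, Real.norm_eq_abs, Real.norm_eq_abs]; exact mul_le_mul (hOb U) (hD U) (abs_nonneg _) hCO⟩
  choose Bg hBg using hgb
  set g : ℕ → Lp ℝ 2 (configMeasure SU2 L) := fun k => (memLp_two_of_bound (μ := configMeasure SU2 L) (hgm k) (hBg k)).toLp _ with hgdef
  have hg_ae : ∀ k, (g k : GaugeConfig 3 L SU2 → ℝ) =ᵐ[configMeasure SU2 L] fun U => O U * ef k U := fun k =>
    (memLp_two_of_bound (μ := configMeasure SU2 L) (hgm k) (hBg k)).coeFn_toLp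
  have hu_ae : ∀ k, (u k : GaugeConfig 3 L SU2 → ℝ) =ᵐ[configMeasure SU2 L] ef k := fun k => coeFn_toL2 (e k)
  -- `⟪b (inl l), g k⟫ = ∫ O e_k e_l`
  have hcoef : ∀ k l, ⟪b (Sum.inl l), g k⟫_ℝ = ∫ U, O U * ef k U * ef l U ∂configMeasure SU2 L := fun k l => by
    rw [hb]
    simp only [hvdef, Sum.elim_inl, hu]
    rw [inner_toL2_left]
    refine integral_congr_ae ?_
    filter_upwards [hg_ae k] with U hU
    rw [hU]; simp only [hef]; ring
  -- `‖g k‖² ≤ CO²`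
  have hgnorm : ∀ k, ‖g k‖ ^ 2 ≤ CO ^ 2 := fun k => by
    rw [← real_inner_self_eq_norm_sq, inner_eq_integral]
    have h1 : ∫ U, (g k) U * (g k) U ∂configMeasure SU2 L = ∫ U, (O U * ef k U) * (O U * ef k U) ∂configMeasure SU2 L :=
      integral_congr_ae (by filter_upwards [hg_ae k] with U hU; rw [hU])
    rw [h1]
    have h2 : ∫ U, ef k U * ef k U ∂configMeasure SU2 L = 1 := by
      have := hon k k; simp only [if_true] at this; exact this
    calc ∫ U, (O U * ef k U) * (O U * ef k U) ∂configMeasure SU2 L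
        ≤ ∫ U, CO ^ 2 * (ef k U * ef k U) ∂configMeasure SU2 L := by
          refine integral_mono_of_nonneg (ae_of_all _ fun U => mul_self_nonneg _) ?_ (ae_of_all _ fun U => ?_)
          · exact ((hef_phys k).integrable_mul (hef_phys k)).const_mul _
          · have hO2 : O U * O U ≤ CO ^ 2 := by
              have := hOb U; rw [abs_le] at this; nlinarith
            have : 0 ≤ ef k U * ef k U := mul_self_nonneg _
            nlinarith
      _ = CO ^ 2 := by rw [integral_const_mul, h2, mul_one]
  refine ⟨ef, hef_phys, hon, heig, fun σ U => rawVacuum_comp_configPerm β (hef_phys 0) (heig 0) σ U, fun k => ?_, fun m hm hmL => ?_⟩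
  · -- Bessel: `Σ_l (∫ O e_k e_l)² ≤ ‖g k‖² ≤ CO²`
    have hpars := hasSum_inner_sq_norm_sq b (g k)
    have hs : Summable fun l : ℕ => ⟪b (Sum.inl l), g k⟫_ℝ ^ 2 := hpars.summable.comp_injective Sum.inl_injective
    have hle : ∑' l : ℕ, ⟪b (Sum.inl l), g k⟫_ℝ ^ 2 ≤ ‖g k‖ ^ 2 := by
      rw [← hpars.tsum_eq]
      have h := tsum_comp_le_tsum_of_inj hpars.summable (fun _ => sq_nonneg _) Sum.inl_injective
      simpa only [Function.comp_def] using h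
    simp only [hcoef] at hs hle
    exact ⟨hs, hle.trans (hgnorm k)⟩
  · -- the double spectral sum
    have hmL' : m ≤ 2 * L - 1 := by omega
    obtain ⟨hKit, Bm, hBm⟩ := measurable_bdd_iterKernelP (L := L) β (m - 1)
    -- the composite bond `X_m`
    set X : GaugeConfig 3 L SU2 → GaugeConfig 3 L SU2 → ℝ := fun x y =>
      O x * ((fun f : GaugeConfig 3 L SU2 → ℝ => fun w => ∫ z, physKernel β w z * f z ∂configMeasure SU2 L)^[m - 1]
        (fun w => physKernel β w y)) x * O y with hXdef
    have hX : StronglyMeasurable (uncurry X) := by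
      have h1 : Measurable (uncurry X) :=
        ((hO.measurable.comp measurable_fst).mul hKit).mul (hO.measurable.comp measurable_snd)
      exact h1.stronglyMeasurable
    have hObn : ∀ U, ‖O U‖ ≤ CO := fun U => by rw [Real.norm_eq_abs]; exact hOb U
    have hCX : ∀ x y, ‖X x y‖ ≤ CO * Bm * CO := fun x y => by
      simp only [hXdef]
      rw [norm_mul, norm_mul]
      have h1 := hBm x y
      exact mul_le_mul (mul_le_mul (hObn x) h1 (norm_nonneg _) hCO) (hObn y) (norm_nonneg _) (mul_nonneg hCO ((norm_nonneg _).trans h1))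
    obtain ⟨Xop, hXop⟩ := exists_kernelOp (μ := configMeasure SU2 L) hX hCX
    -- Literature: the one-bond-insertion spectral sum
    have hmain := hasSum_integral_iterate_insert_one (μ := configMeasure SU2 L) (b := b) hKP hCP (physKernel_symm β) hAP hbAP hX hCX hXop
      (2 * L - m - 2)
    rw [show 2 * L - m - 2 + 1 = 2 * L - 1 - m by omega, ← insTrace_eq_insertOne β hO hm hmL'] at hmain
    -- the diagonal matrix elements: `⟪b (inl k), 𝕏 b (inl k)⟫ = ⟪g k, A_P^m g k⟫`
    have hdiag : ∀ k, ⟪b (Sum.inl k), Xop (b (Sum.inl k))⟫_ℝ = ⟪g k, (AP ^ m) (g k)⟫_ℝ := by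
      intro k
      rw [inner_kernelOp_eq_integral hXop, inner_eq_integral, hb]
      simp only [hvdef, Sum.elim_inl]
      have hpow := pow_kernelOp_toLp_ae_eq_iterate (μ := configMeasure SU2 L) hAP (hgm k) (hBg k) m
      refine integral_congr_ae ?_
      filter_upwards [hu_ae k, hg_ae k, hpow] with x hx hgx hpx
      rw [hx, hgx, hpx]
      have hin : ∫ y, X x y * (u k : GaugeConfig 3 L SU2 → ℝ) y ∂configMeasure SU2 L = ∫ y, X x y * ef k y ∂configMeasure SU2 L :=
        integral_congr_ae (by filter_upwards [hu_ae k] with y hy; rw [hy])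
      rw [hin]
      simp only [hXdef]
      have key := integral_iterKernelP_mul (L := L) β (hgm k) (hBg k) (m - 1) x
      rw [show m - 1 + 1 = m by omega] at key
      rw [← key, ← integral_const_mul, ← integral_const_mul]
      exact integral_congr_ae (ae_of_all _ fun y => by ring)
    -- opening the diagonal matrix element: `⟪g k, A_P^m g k⟫ = Σ_l λ_l^m (∫ O e_k e_l)²`
    have hinner : ∀ k, HasSum (fun l : ℕ => levelValue su2Rep L β l ^ m * (∫ U, O U * ef k U * ef l U ∂configMeasure SU2 L) ^ 2)
        ⟪g k, (AP ^ m) (g k)⟫_ℝ := by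
      intro k
      have h := hasSum_inner_pow_apply_self b hsaP hbAP m (g k)
      have h0 : ∀ i ∉ Set.range (Sum.inl : ℕ → ℕ ⊕ w), lam i ^ m * ⟪b i, g k⟫_ℝ ^ 2 = 0 := by
        rintro (n | j) hn
        · exact absurd (Set.mem_range_self n) hn
        · simp only [hlamdef, Sum.elim_inr]
          rw [zero_pow (by omega), zero_mul]
      have h2 := (Function.Injective.hasSum_iff Sum.inl_injective h0).mpr h
      refine h2.congr_fun fun l => ?_
      simp only [Function.comp_apply, hlamdef, Sum.elim_inl, hcoef]
    -- the outer sum over `ℕ`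
    have houter : HasSum (fun k : ℕ => levelValue su2Rep L β k ^ (2 * L - m) * ⟪g k, (AP ^ m) (g k)⟫_ℝ) (insTrace L β O m) := by
      have h0 : ∀ i ∉ Set.range (Sum.inl : ℕ → ℕ ⊕ w), lam i ^ (2 * L - m - 2 + 2) * ⟪b i, Xop (b i)⟫_ℝ = 0 := by
        rintro (n | j) hn
        · exact absurd (Set.mem_range_self n) hn
        · simp only [hlamdef, Sum.elim_inr]
          rw [zero_pow (by omega), zero_mul]
      have h2 := (Function.Injective.hasSum_iff Sum.inl_injective h0).mpr hmain
      refine h2.congr_fun fun k => ?_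
      simp only [Function.comp_apply, hlamdef, Sum.elim_inl, hdiag k, show 2 * L - m - 2 + 2 = 2 * L - m by omega]
    -- iterated sum of non-negative terms ⇒ double sum
    set F : ℕ × ℕ → ℝ := fun p => levelValue su2Rep L β p.1 ^ (2 * L - m) * levelValue su2Rep L β p.2 ^ m *
      (∫ U, O U * ef p.1 U * ef p.2 U ∂configMeasure SU2 L) ^ 2 with hF
    have hF0 : ∀ p, 0 ≤ F p := fun p =>
      mul_nonneg (mul_nonneg (pow_nonneg (levelValue_su2Rep_pos hβ _).le _) (pow_nonneg (levelValue_su2Rep_pos hβ _).le _)) (sq_nonneg _)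
    have hfib : ∀ k, HasSum (fun l => F (k, l)) (levelValue su2Rep L β k ^ (2 * L - m) * ⟪g k, (AP ^ m) (g k)⟫_ℝ) := fun k => by
      have h := (hinner k).mul_left (levelValue su2Rep L β k ^ (2 * L - m))
      refine h.congr_fun fun l => ?_
      simp only [hF]; ring
    have hsumF : Summable F := by
      refine (summable_prod_of_nonneg hF0).mpr ⟨fun k => (hfib k).summable, ?_⟩
      refine houter.summable.congr fun k => ?_
      exact ((hfib k).tsum_eq).symm
    have htot := hsumF.hasSum.prod_fiberwise hfib
    have heq : ∑' p, F p = insTrace L β O m := htot.unique houter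
    rw [← heq]
    exact hsumF.hasSum

end Summit.QuantumFields.YangMills.Theorems.FemtoTransferGap.TT

end
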